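import Summits.HodgeConjecture.HodgeConjecture.Theorems.Ring2WeilCoverageWeilGramLevel21
import Summits.HodgeConjecture.HodgeConjecture.Theorems.Ring2WeilCoverageWeilGramSign
import HarnessLib

/-!
# Weil-type family coverage — THE COMPONENTS OF THE WEIL-TYPE `ℤ[ζ₂₁]`-SIXFOLDS, II: `θ^i` (`i < 6`) is a `ℚ`-basis of
# `ℚ(ζ₂₁)⁺`; EVERY principal-type `E_ζ′` has Gram determinant `1728` against `√−3`; hence NO principal-type `E_ζ′` is
# `Φ`-positive on a `ℚ(√−3)`-Weil-type CM type — the census NO row `(21, ℚ(√−3))` from van Geemen's SIGN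

research route conditional on HC_CM; not a corollary; Q11.4-sentence-2 already refuted in dim ≥ 3.

Ring 2, WEIL-TYPE FAMILY-COVERAGE CENSUS (`HOME/WEIL-FAMILY-COVERAGE.md` `## b01`, blocks b01.34 (the NO row
`(ℚ(ζ₂₁), √−3)`), b01.41 (C), b01.47 (E)), part 99 of the `Ring2WeilCoverage*` series; continues part 98
(`Ring2WeilCoverageWeilGramLevel21`: traces, Hankel matrix, `det a = 1728`).

* §2 `[ℚ(ζ₂₁)⁺ : ℚ] = 6` and **`1, θ, …, θ⁵` is a `ℚ`-basis of `ℚ(ζ₂₁)⁺`** (independence: trace a relation against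
  `ξ s₃ θ^m`, `m ≤ 5`, and invert the `6 × 6` Hankel matrix of part 98).
* §3 **EVERY skew `ζ′` of principal type on `ℤ[ζ₂₁]` gives `det a = 1728`** against `s₃` (part 82
  `det_realPart_eq_of_isOfType` + THEOREM L (i) at `21`, `norm_realUnits_pos_twentyOne`).
* §4 **NO such `ζ′` is `Φ`-positive on a CM type of `s₃`-signature `(3,3)`**: `(−1)³·1728 < 0` against part 92
  `not_pos_of_neg_one_pow_mul_det_nonpos` — the census verdict `not_exists_principal_twentyOne_sqrt_neg_three`
  (parts 7/8: unit signatures) by a second, independent kernel route (van Geemen's sign of `det H`).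

HONEST FRAMING as part 98; `HC_CM` is used nowhere.  No `def`, no named fact, no `sorry`.

References: [cite: vanGeemen1994HodgeAV, Lemma 5.2 (2)–(4), 5.4 and (5.4.1)]; [cite: Shimura1998, §14.3 Prop. 4–5,
pp. 103–104]; census b01.34, b01.41 (C) (seat-derived).
-/

noncomputable section

open Polynomial NumberField Module
open scoped nonZeroDivisors

namespace Summit.HodgeConjecture.Ring2WeilCoverage.WeilGramLevel21Principal

open Literature.AlgebraicGeometry.VanGeemen1994 (weilField weilNormResidueGroup)
open Literature.AlgebraicGeometry.Motives (CMType normUnitsSubgroup)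
open Literature.NumberTheory.ComplexMultiplication
open Summit.HodgeConjecture.Ring2WeilCoverage.TraceGramDeterminant (trace_aeval_zeta_mul_inv)
open Summit.HodgeConjecture.Ring2WeilCoverage.WeilGramCMPoint
open Summit.HodgeConjecture.Ring2WeilCoverage.RealUnitNormHalfSystems (complexConj_eq_inv)
open Summit.HodgeConjecture.Ring2WeilCoverage.CyclotomicPrincipalObstruction (complexConj_xi)
open Summit.HodgeConjecture.Ring2WeilCoverage.CyclotomicDifferent (isOfType_one_xi_top xi_ne_zero)
open Summit.HodgeConjecture.HodgeConjecture.Ring2.WeilCoverage (mk_neg_eq_split_of_odd mk_neg_ne_split_of_odd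
  mem_normUnitsSubgroup_of_sq_add_mul_sq)
open Summit.HodgeConjecture.HodgeConjecture.Ring2.Hypotheses (splitDiscriminantClass)
open Summit.HodgeConjecture.Ring2WeilCoverage.WeilGramLevel21
open Summit.HodgeConjecture.Ring2WeilCoverage.WeilGramSign (not_pos_of_neg_one_pow_mul_det_nonpos)
open Summit.HodgeConjecture.Ring2WeilCoverage.RealQuadraticUnitNorm (norm_realUnits_pos_twentyOne)
variable {K : Type} [Field K] [NumberField K] {ζ : K}

/-! ### §2 `1, θ, …, θ⁵` is a `ℚ`-basis of `K⁺ = ℚ(ζ₂₁)⁺` -/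

/-- `[ℚ(ζ_21)⁺ : ℚ] = 6`. [folklore] -/
theorem finrank_realSubfield [IsCyclotomicExtension {21} ℚ K] [IsCMField K] :
    finrank ℚ (maximalRealSubfield K) = 6 := by
  have h1 : finrank ℚ K = 12 := by
    rw [IsCyclotomicExtension.finrank K (cyclotomic.irreducible_rat (by norm_num : 0 < 21))]; decide
  have h2 := Module.finrank_mul_finrank ℚ (maximalRealSubfield K) K
  rw [Algebra.IsQuadraticExtension.finrank_eq_two (maximalRealSubfield K) K, h1] at h2
  omega

/-- **`1, θ, …, θ⁵` are `ℚ`-linearly independent in `K⁺`**: a relation `Σ cₖ θ^k = 0`, multiplied by `ζ′ s θ^m` and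
traced, gives the Hankel system of §1 (`m ≤ 5`), whose determinant is non-zero.
research route conditional on HC_CM; not a corollary; Q11.4-sentence-2 already refuted in dim ≥ 3. [folklore] -/
theorem linearIndependent_thetaPow [IsCyclotomicExtension {21} ℚ K] [IsCMField K] (hζ : IsPrimitiveRoot ζ 21)
    {ω : Fin 6 → maximalRealSubfield K} (hω : ∀ i, (ω i : K) = (ζ + ζ⁻¹) ^ (i : ℕ)) : LinearIndependent ℚ ω := by
  rw [Fintype.linearIndependent_iff]
  intro c hc
  have hcK : ∑ i : Fin 6, (c i : K) * (ζ + ζ⁻¹) ^ (i : ℕ) = 0 := by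
    have h := congrArg (fun y : maximalRealSubfield K => (y : K)) hc
    simp only [ZeroMemClass.coe_zero] at h
    rw [← h]
    push_cast
    refine Finset.sum_congr rfl fun i _ => ?_
    rw [Rat.smul_def, hω i]
  have E : ∀ m : ℕ, ∑ i : Fin 6, c i * Algebra.trace ℚ K ((ζ ^ 5 * (aeval ζ (derivative (cyclotomic 21 ℚ)))⁻¹) * (1 + 2 * ζ ^ 7) *
      (ζ + ζ⁻¹) ^ (m + (i : ℕ))) = 0 := by
    intro m
    have h := congrArg (fun y => Algebra.trace ℚ K ((ζ ^ 5 * (aeval ζ (derivative (cyclotomic 21 ℚ)))⁻¹) * (1 + 2 * ζ ^ 7) * (ζ + ζ⁻¹) ^ m * y)) hcK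
    simp only [mul_zero, map_zero, Finset.mul_sum, map_sum] at h
    rw [← h]
    refine Finset.sum_congr rfl fun i _ => ?_
    rw [show (ζ ^ 5 * (aeval ζ (derivative (cyclotomic 21 ℚ)))⁻¹) * (1 + 2 * ζ ^ 7) * (ζ + ζ⁻¹) ^ m *
        ((c i : K) * (ζ + ζ⁻¹) ^ (i : ℕ)) = (c i) • ((ζ ^ 5 * (aeval ζ (derivative (cyclotomic 21 ℚ)))⁻¹) * (1 + 2 * ζ ^ 7) *
        (ζ + ζ⁻¹) ^ (m + (i : ℕ))) by rw [Rat.smul_def, pow_add]; ring, map_smul, smul_eq_mul]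
  have e0 := E 0
  have e1 := E 1
  have e2 := E 2
  have e3 := E 3
  have e4 := E 4
  have e5 := E 5
  simp only [Fin.sum_univ_six, Fin.isValue, Fin.val_zero, Fin.val_one, Fin.val_two, show ((3 : Fin 6) : ℕ) = 3 from rfl,
    show ((4 : Fin 6) : ℕ) = 4 from rfl, show ((5 : Fin 6) : ℕ) = 5 from rfl,
    Nat.reduceAdd, zero_add, add_zero, pow_zero, mul_one, pow_one, trace_xi_sqrtNegThree_zero hζ, trace_xi_sqrtNegThree_one hζ, trace_xi_sqrtNegThree_two hζ,
    trace_xi_sqrtNegThree_three hζ, trace_xi_sqrtNegThree_four hζ, trace_xi_sqrtNegThree_five hζ,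
    trace_xi_sqrtNegThree_six hζ, trace_xi_sqrtNegThree_seven hζ, trace_xi_sqrtNegThree_eight hζ,
    trace_xi_sqrtNegThree_nine hζ, trace_xi_sqrtNegThree_ten hζ] at e0 e1 e2 e3 e4 e5
  have c0 : c 0 = 0 := by linear_combination ((31 : ℚ) / 6) * e0 + ((-25 : ℚ) / 3) * e1 + (-4 : ℚ) * e2 + (6 : ℚ) * e3 + ((2 : ℚ) / 3) * e4 +
    (-1 : ℚ) * e5
  have c1 : c 1 = 0 := by linear_combination ((-25 : ℚ) / 3) * e0 + ((64 : ℚ) / 3) * e1 + (7 : ℚ) * e2 + ((-49 : ℚ) / 3) * e3 + ((-7 : ℚ) / 6) * e4 +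
    ((17 : ℚ) / 6) * e5
  have c2 : c 2 = 0 := by linear_combination (-4 : ℚ) * e0 + (7 : ℚ) * e1 + ((5 : ℚ) / 3) * e2 + ((-19 : ℚ) / 6) * e3 + ((-1 : ℚ) / 6) * e4 +
    ((1 : ℚ) / 3) * e5
  have c3 : c 3 = 0 := by linear_combination (6 : ℚ) * e0 + ((-49 : ℚ) / 3) * e1 + ((-19 : ℚ) / 6) * e2 + ((71 : ℚ) / 6) * e3 + ((1 : ℚ) / 3) * e4 +
    (-2 : ℚ) * e5
  have c4 : c 4 = 0 := by linear_combination ((2 : ℚ) / 3) * e0 + ((-7 : ℚ) / 6) * e1 + ((-1 : ℚ) / 6) * e2 + ((1 : ℚ) / 3) * e3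
  have c5 : c 5 = 0 := by linear_combination (-1 : ℚ) * e0 + ((17 : ℚ) / 6) * e1 + ((1 : ℚ) / 3) * e2 + (-2 : ℚ) * e3 + ((1 : ℚ) / 3) * e5
  intro i
  fin_cases i
  · exact c0
  · exact c1
  · exact c2
  · exact c3
  · exact c4
  · exact c5

/-- **A `ℚ`-basis `ωb` of `K⁺ = ℚ(ζ_21)⁺ with `ωb i = θ^i`** (`i < 6`). [folklore] -/
theorem exists_basis_thetaPow [IsCyclotomicExtension {21} ℚ K] [IsCMField K] (hζ : IsPrimitiveRoot ζ 21) :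
    ∃ ωb : Basis (Fin 6) ℚ (maximalRealSubfield K), ∀ i, (ωb i : K) = (ζ + ζ⁻¹) ^ (i : ℕ) := by
  let θ' : maximalRealSubfield K :=
    ⟨ζ + ζ⁻¹, (IsCMField.complexConj_eq_self_iff K (ζ + ζ⁻¹)).mp (complexConj_theta hζ)⟩
  let ω : Fin 6 → maximalRealSubfield K := fun i => θ' ^ (i : ℕ)
  have hω : ∀ i, (ω i : K) = (ζ + ζ⁻¹) ^ (i : ℕ) := fun i => by simp [ω, θ']
  have hli := linearIndependent_thetaPow hζ hω
  have hcard : Fintype.card (Fin 6) = finrank ℚ (maximalRealSubfield K) := by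
    rw [Fintype.card_fin, finrank_realSubfield]
  exact ⟨basisOfLinearIndependentOfCardEqFinrank hli hcard, fun i => by
    rw [coe_basisOfLinearIndependentOfCardEqFinrank]; exact hω i⟩

/-! ### §3 Every principal-type parameter gives `1728` against `s₃` (THEOREM L (i) at `21`) -/

/-- **For EVERY skew `ζ′` of PRINCIPAL type on `ℤ[ζ_21]` (`IsOfType 1 ζ′ ⊤`; `ζ′ = uξ`, `u` a real unit, `N(u) = 1`
by THEOREM L (i) at `21`) the Gram determinant of `(E_ζ′, s₃)` in the frame `θ^i` is `1728`** (such `ζ′` exist for SOME `Φ`, but — §4 — for no `ℚ(√−3)`-Weil-type `Φ`): the census NO row `(21, ℚ(√−3))`;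
`(−1)³ det a < 0`: the WRONG sign for Weil signature `(3,3)` [vG94 5.2 (4)] — see the NO-row theorem below.
research route conditional on HC_CM; not a corollary; Q11.4-sentence-2 already refuted in dim ≥ 3. [cite: vanGeemen1994HodgeAV, Lemma 5.2 (3)–(4) and (5.4.1)] [cite: Shimura1998, §14.3 Prop. 5, p. 104] -/
theorem det_realPart_principal_sqrtNegThree [IsCyclotomicExtension {21} ℚ K] [IsCMField K]
    (hζ : IsPrimitiveRoot ζ 21) {ζ' : K} (hζ' : IsCMField.complexConj K ζ' = -ζ')
    (hT : CMTypeLattice.IsOfType (1 : (FractionalIdeal (𝓞 K)⁰ K)ˣ) ζ' ⊤)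
    {x : Fin 6 → K} (hx : ∀ i, x i = (ζ + ζ⁻¹) ^ (i : ℕ)) {a : Matrix (Fin 6) (Fin 6) ℚ}
    (ha : ∀ i j, a i j = Algebra.trace ℚ K (ζ' * x i * IsCMField.complexConj K ((1 + 2 * ζ ^ 7) * x j))) :
    a.det = 1728 := by
  obtain ⟨ωb, hωb⟩ := exists_basis_thetaPow hζ
  have hx' : ∀ i, x i = (ωb i : K) := fun i => (hx i).trans (hωb i).symm
  rw [det_realPart_eq_of_isOfType ωb (complexConj_sqrtNegThree hζ) hx' (norm_realUnits_pos_twentyOne hζ)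
    (complexConj_xi_twentyOne hζ) (xi_ne_zero hζ 5) hζ' (isOfType_one_xi_top hζ 5) hT (fun i j => rfl) ha]
  exact det_realPart_xi_sqrtNegThree hζ hx (fun i j => rfl)

/-! ### §4 The NO row `(21, ℚ(√−3))` from the sign of `det H` -/

open scoped Classical in
/-- **NO principal-type `E_ζ′` on `ℤ[ζ_21]` is `Φ`-positive on a `ℚ(√−3)`-signature-`(3,3)` CM type** (`s = √−3 = 1 + 2ζ⁷`):
`det a = 1728 > 0` for every skew principal-type `ζ′` (above), while van Geemen's sign would force `0 < (−1)³ det a`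
(part 92 `not_pos_of_neg_one_pow_mul_det_nonpos`) — the census NO row `(21, ℚ(√−3))` (b01.34, THEOREM L there via
unit signatures) RE-DERIVED from a determinant sign.
research route conditional on HC_CM; not a corollary; Q11.4-sentence-2 already refuted in dim ≥ 3. [cite: vanGeemen1994HodgeAV, Lemma 5.2 (4)] [cite: Shimura1998, §14.3 Prop. 4–5, pp. 103–104] -/
theorem not_pos_of_principal_sqrtNegThree [IsCyclotomicExtension {21} ℚ K] [IsCMField K] (hζ : IsPrimitiveRoot ζ 21)
    (Φ : CMType K)
    (hneg : (Finset.univ.filter fun φ : Φ.1 => (φ.1 (1 + 2 * ζ ^ 7)).im < 0).card = 3)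
    (hposc : (Finset.univ.filter fun φ : Φ.1 => 0 < (φ.1 (1 + 2 * ζ ^ 7)).im).card = 3)
    {ζ' : K} (hζ' : IsCMField.complexConj K ζ' = -ζ')
    (hT : CMTypeLattice.IsOfType (1 : (FractionalIdeal (𝓞 K)⁰ K)ˣ) ζ' ⊤) :
    ¬ ∀ φ : Φ.1, 0 < (φ.1 ζ').im := by
  obtain ⟨ωb, hωb⟩ := exists_basis_thetaPow hζ
  have hs := complexConj_sqrtNegThree hζ
  have hs0 : ((1 + 2 * ζ ^ 7) : K) ≠ 0 := fun h => by
    have h2 := sq_sqrtNegThree hζ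
    rw [h] at h2
    norm_num at h2
  obtain ⟨γ₀, hγ⟩ := exists_real_eq_mul_of_skew hζ' hs
  set A : Matrix (Fin 6) (Fin 6) ℚ := Matrix.of fun i j => Algebra.trace ℚ K (ζ' * (ωb i : K) *
      IsCMField.complexConj K ((1 + 2 * ζ ^ 7) * (ωb j : K))) with hA
  have hA' : ∀ i j, A i j = Algebra.trace ℚ K (ζ' * (ωb i : K) *
      IsCMField.complexConj K ((1 + 2 * ζ ^ 7) * (ωb j : K))) := fun i j => rfl
  have hdet := det_realPart_principal_sqrtNegThree hζ hζ' hT (x := fun i => (ωb i : K)) hωb hA'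
  have hζ'0 : ζ' ≠ 0 := by
    intro h0
    have hzero : A = 0 := by
      ext i j
      simp [hA, h0]
    rw [hzero, Matrix.det_zero] at hdet
    norm_num at hdet
  exact not_pos_of_neg_one_pow_mul_det_nonpos Φ ωb hζ' hs hs0 hζ'0 hneg hposc (fun i => rfl) hγ hA'
    (by rw [hdet]; norm_num)

end Summit.HodgeConjecture.Ring2WeilCoverage.WeilGramLevel21Principal

end
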